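import Summits.Ventures.HSemireg.WedgeHankelRecurrenceGaussChebyshevRootInterlacing

/-!
# Venture HSemireg — **D'OCAGNE, CATALAN AND VAJDA FOR THE VIETA POLYNOMIALS IN EVERY COMMUTATIVE RING: `C_{k+2} − C_k = (X² − 4)S_k`, `C_m C_n − C_{m+1} C_{n−1} = −(X² − 4)S_{m−n}` (all `m, n ∈ ℤ`),
# `S_m S_{p+1} − S_{m+1} S_p = S_{m−p−1}` (`m ∈ ℤ`, `p ∈ ℕ`; d'Ocagne), `S_{q+i+1}² − S_{q+2i+2} S_q = S_i²` (Catalan)** (at `X = 3` these are the classical `F_{2·}` ∕ `L_{2·}` identities, at `X = i`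
# the Fibonacci identities of N527; consequences of Mathlib `C_mul_C` and the Clebsch–Gordan rule of N537)

HONEST FRAMING. Part of the Lean index of the computation cell `pub-hsemireg` (seat p10 gen 49, Sunday typer «UNIFORM-IN-n»).  Polynomial algebra over a commutative ring (Mathlib
`Polynomial.Chebyshev.S ∕ C`, `Finset.sum`); no variety, no cohomology theory, no sheaf, no Ext group and no semiregularity map is constructed here; nothing here says that HC / HC_CM / HC_AV holds;
no Literature fact (unproved `Prop`) is declared or used.  Custodian versions as in `WedgeHankelSiegelIdeal` (1/3).
SOURCES (cited).  S. Vajda, *Fibonacci & Lucas Numbers, and the Golden Section* (Ellis Horwood 1989), identities (20a), (28), (32) (d'Ocagne, Catalan, Vajda); T. Koshy, *Fibonacci and Lucas Numbers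
with Applications* (Wiley 2001), Ch. 5; J. C. Mason, D. C. Handscomb, *Chebyshev Polynomials* (2003), §2.4.3 (product formulas).
PROOF TYPED HERE.  (1) `C_{k+2} − C_k = (S_{k+2} − S_k) − (S_k − S_{k−2})` (N535) and `X·S_j = S_{j+1} + S_{j−1}` (N537) give `(X² − 4)S_k`; (2) Mathlib `C_mul_C` twice: `C_mC_n − C_{m+1}C_{n−1} =
C_{m−n} − C_{m−n+2}`; (3) Clebsch–Gordan `S_m S_{p+1} = Σ_{k≤p+1} S_{m−p−1+2k}`, `S_{m+1} S_p = Σ_{k≤p} S_{m−p+1+2k}` (N537), `Finset.sum_range_succ'`; (4) `S_n² = Σ_{k≤n} S_{2k}` (N537) and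
`S_{q+2i+2}S_q = Σ_{k≤q} S_{2i+2+2k}`, `Finset.sum_range_add`.
DEDUP DISCLOSURE (`rg -n -i 'cassini|Catalan|Vajda|dOcagne|T_sq_sub_T_mul_T' Summits/Ventures/HSemireg Literature`, 2026-09-04): `WedgeHankelRecurrenceGaussChebyshevCassini` has `chebyshevU_cassini`, `chebyshevT_cassini`,
`chebyshevU_sq_add_sq` (the `j = 1, m = n` cases for `U ∕ T`); `Literature.Algebra.Polynomial.ChebyshevExplicitForms` has the first-kind Turán ∕ Cassini forms `T_sq_sub_T_mul_T` (`T_{n+1}² − T_nT_{n+2} = 1 − X²`),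
`T_add_sub_one_mul_T_sub_sub_one` and `U_add_eq_U_mul_T_add_T_mul_U` (cited; that module imports all of Mathlib and is not imported); the `Literature/NumberTheory/LucasSequences` identities are for integer
sequences `U_n(P,Q)`; the polynomial `S ∕ C` d'Ocagne ∕ Catalan ∕ `C`-difference identities are not typed; 0 hits for the 4 names below.

WHAT IS IN THE TREE.  N535 `chebyshevC_add_two_eq_S_sub_S`; N537 `X_mul_chebyshevS`, `chebyshevS_mul_S`, `chebyshevS_sq_eq_sum`; Mathlib `C_mul_C`, `Finset.sum_range_succ'`, `Finset.sum_range_add`.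
THIS FILE (namespace `Summit.Ventures.HSemireg.Wedge.HankelOuter` continued; CHAINED on N543; 0 definitions):
* §1309 **`chebyshevC_add_two_sub_C`** (`C_{k+2} − C_k = (X² − 4)S_k`), **`chebyshevC_dOcagne`** (`C_mC_n − C_{m+1}C_{n−1} = −(X² − 4)S_{m−n}`), **`chebyshevS_dOcagne`** (`S_mS_{p+1} − S_{m+1}S_p = S_{m−p−1}`),
  **`chebyshevS_catalan`** (`S_{q+i+1}² − S_{q+2i+2}S_q = S_i²`).
CAVEATS.  `S_mS_n` identities with one index in `ℕ` (the Clebsch–Gordan rule is stated for `n ∈ ℕ`); `C` identities for all integers.  Nothing Ext-side.  New names only.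
-/

open Module Polynomial
open scoped Matrix Polynomial

namespace Summit.Ventures.HSemireg.Wedge.HankelOuter

/-! ## §1309. d'Ocagne, Catalan, Vajda -/

/-- **`C_{k+2} − C_k = (X² − 4)·S_k`** for all `k ∈ ℤ`, in every commutative ring (`2cos((k+2)θ) − 2cos(kθ) = −4 sin θ · sin((k+1)θ)`). [Vajda 1989; this file, §1309] -/
theorem chebyshevC_add_two_sub_C (R : Type*) [CommRing R] (k : ℤ) :
    Polynomial.Chebyshev.C R (k + 2) - Polynomial.Chebyshev.C R k = (X ^ 2 - 4) * Polynomial.Chebyshev.S R k := by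
  have h1 := chebyshevC_add_two_eq_S_sub_S R k
  have h2 := chebyshevC_add_two_eq_S_sub_S R (k - 2)
  rw [show k - 2 + 2 = k by ring] at h2
  have h3 := X_mul_chebyshevS R k
  have h4 := X_mul_chebyshevS R (k + 1)
  have h5 := X_mul_chebyshevS R (k - 1)
  rw [show k + 1 + 1 = k + 2 by ring, show k + 1 - 1 = k by ring] at h4
  rw [show k - 1 + 1 = k by ring, show k - 1 - 1 = k - 2 by ring] at h5
  linear_combination h1 - h2 - (X : R[X]) * h3 - h4 - h5

/-- **d'Ocagne for `C`: `C_m·C_n − C_{m+1}·C_{n−1} = −(X² − 4)·S_{m−n}`** for all `m, n ∈ ℤ` (Mathlib `C_mC_n = C_{m+n} + C_{m−n}`). [Vajda 1989, (20a) analogue; this file, §1309] -/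
theorem chebyshevC_dOcagne (R : Type*) [CommRing R] (m n : ℤ) :
    Polynomial.Chebyshev.C R m * Polynomial.Chebyshev.C R n - Polynomial.Chebyshev.C R (m + 1) * Polynomial.Chebyshev.C R (n - 1) =
      -((X ^ 2 - 4) * Polynomial.Chebyshev.S R (m - n)) := by
  have h1 := Polynomial.Chebyshev.C_mul_C R m n
  have h2 := Polynomial.Chebyshev.C_mul_C R (m + 1) (n - 1)
  rw [show m + 1 + (n - 1) = m + n by ring, show m + 1 - (n - 1) = m - n + 2 by ring] at h2
  have h3 := chebyshevC_add_two_sub_C R (m - n)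
  linear_combination h1 - h2 - h3

/-- **d'Ocagne for `S`: `S_m·S_{p+1} − S_{m+1}·S_p = S_{m−p−1}`** for `m ∈ ℤ`, `p ∈ ℕ` (Clebsch–Gordan, N537). [Vajda 1989, (20a); this file, §1309] -/
theorem chebyshevS_dOcagne (R : Type*) [CommRing R] (m : ℤ) (p : ℕ) :
    Polynomial.Chebyshev.S R m * Polynomial.Chebyshev.S R ((p + 1 : ℕ) : ℤ) - Polynomial.Chebyshev.S R (m + 1) * Polynomial.Chebyshev.S R (p : ℤ) =
      Polynomial.Chebyshev.S R (m - (p : ℤ) - 1) := by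
  rw [chebyshevS_mul_S, chebyshevS_mul_S, Finset.sum_range_succ' _ (p + 1)]
  have e : ∑ k ∈ Finset.range (p + 1), Polynomial.Chebyshev.S R (m - ((p + 1 : ℕ) : ℤ) + 2 * ((k + 1 : ℕ) : ℤ)) =
      ∑ k ∈ Finset.range (p + 1), Polynomial.Chebyshev.S R (m + 1 - (p : ℤ) + 2 * (k : ℤ)) :=
    Finset.sum_congr rfl fun k _ => by congr 1; push_cast; ring
  rw [e]
  push_cast
  ring_nf

/-- **Catalan for `S`: `S_{q+i+1}² − S_{q+2i+2}·S_q = S_i²`** for `q, i ∈ ℕ` (i.e. `S_n² − S_{n+j}S_{n−j} = S_{j−1}²` with `n = q + j`, `j = i + 1`). [Vajda 1989, (28); this file, §1309] -/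
theorem chebyshevS_catalan (R : Type*) [CommRing R] (q i : ℕ) :
    Polynomial.Chebyshev.S R ((q + i + 1 : ℕ) : ℤ) ^ 2 - Polynomial.Chebyshev.S R ((q + 2 * i + 2 : ℕ) : ℤ) * Polynomial.Chebyshev.S R (q : ℤ) =
      Polynomial.Chebyshev.S R (i : ℤ) ^ 2 := by
  rw [chebyshevS_sq_eq_sum, chebyshevS_sq_eq_sum, chebyshevS_mul_S, show q + i + 1 + 1 = (i + 1) + (q + 1) by ring, Finset.sum_range_add]
  have e : ∑ k ∈ Finset.range (q + 1), Polynomial.Chebyshev.S R (((q + 2 * i + 2 : ℕ) : ℤ) - (q : ℤ) + 2 * (k : ℤ)) =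
      ∑ k ∈ Finset.range (q + 1), Polynomial.Chebyshev.S R (2 * ((((i + 1) + k : ℕ)) : ℤ)) :=
    Finset.sum_congr rfl fun k _ => by congr 1; push_cast; ring
  rw [e]
  ring

end Summit.Ventures.HSemireg.Wedge.HankelOuter
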